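import Literature.AnabelianGeometry.SemiGraphs.OncePuncturedTemperedGroupWitness
import Literature.AnabelianGeometry.SemiGraphs.TemperedCurveHyperbolicWitness
import Literature.AnabelianGeometry.SemiGraphs.TemperedCurveGalois
import Literature.AnabelianGeometry.SemiGraphs.TemperedCurveGroupLevelDataNonVacuity2
import Literature.AnabelianGeometry.SemiGraphs.CoverticialCoveringGroupLemmas
import Literature.AnabelianGeometry.AbsoluteAnabelian.SubpadicSlimProofs
import Literature.AnabelianGeometry.AbsoluteAnabelian.SubpadicExamples
import Literature.NumberTheory.LocalFields.PadicGaloisSecondCountable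
import HarnessLib

/-!
# [SemiAnbd] Theorem 6.5 (iii) AS TYPED FAILS at the genuine-arithmetic §6 datum `G_{ℚ_p} × F̂₂`
# for `Y = X` and a NON-TRIVIAL automorphism (negative companion of the Thm. 6.5 non-vacuity witness)

Mochizuki, *Semi-graphs of anabelioids*, Publ. RIMS **42** (2006) [SemiAnbd], Theorem 6.5 (iii)
(Absoluteness of Cuspidal Decomposition Groups), p. 72: "Every isomorphism of tempered groups
`α : Π^temp_{X_K} ≅ Π^temp_{Y_L}` preserves cuspidal decomposition groups and cuspidal geometric
decomposition groups." [cite: MochizukiSemiAnbd2006, Thm 6.5(iii) p.72]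

PROOF-ONLY file (abc-iut cell, NV lane row «GroupLevelData genuine-arith+slim-Δ+cusp», prover
abc-iut-w5-d040; no definition).  The typed predicate `TemperedCurve.IsoPreservesCuspidalDecomp X Y`
(abc-iut-L3-t2) quantifies over ALL isomorphisms of the abstract tempered groups; the cell consumes it as
a hypothesis (`h65`, `h65′` in the Thm. 6.8 (iii) / [Mzk8] Cor. 2.5 assemblies of abc-iut-w5-d040 gen 0)
and, over a certified origin, as `TemperedOrigin.CuspidalAbsolutenessHolds`.  The companion file
`TemperedCurveThm65NonVacuity.lean` shows Thm. 6.5 (i)(ii)(iv) HOLD at the datum `K = ℚ_p`,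
`Π^temp := G_{ℚ_p} × F̂₂`, one cusp with `I_x = 1 × îa(Ẑ)`; HERE we show that (iii) FAILS there:

* `exists_temperedCurve_not_isoPreservesCuspidalDecomp` — at that datum (rebuilt inside the proof, with
  the same properties: `G_K = G_{ℚ_p}`, `GroupLevelData`, a cusp, nonabelian slim `Δ^temp`), the
  automorphism `α := id × ŝ`, `ŝ` the profinite completion of the swap `a ↔ b` of the free generators
  (`ProfiniteCompletion.lift` of `η ∘ swap`, an involution by density), maps the cuspidal geometric
  decomposition group `I_x ∋ (1, η a)` to a group containing `(1, η b)`; a conjugate `c I_x c⁻¹` is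
  `1 × c₂ îa(Ẑ) c₂⁻¹`, on which the completed exponent sum `ê_a` is determined (`ê_a ∘ îa = id`), while
  `ê_a(η b) = 1` — forcing `η b = 1`, absurd since `ê_b(η b) = ι(1) ≠ 1`.  So
  `¬ IsoPreservesCuspidalDecomp X X`.
* (The FACT-LIST row F-1704 `TemperedOrigin.CuspidalAbsolutenessHolds` was settled as «∀Ω-closure
  REFUTED» by abc-iut-f-056's `TemperedCurve.not_forall_cuspidalAbsolutenessHolds` (p430078, via a
  point-deleted copy `Y` of the toy and `α = id`); the present theorem is the sharper SAME-DATUM form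
  `¬ IsoPreservesCuspidalDecomp X X`, which no `α = id` argument can give, and is not restated as an
  `∀ Ω` corollary to avoid a twin.)

HONEST FRAMING.  This is a statement about the ABSTRACT interface at a toy datum (a direct product with
`I_x` generated by a free generator): for the tempered fundamental group of an actual curve, Thm. 6.5
(iii) is Mochizuki's theorem and is not questioned here; the point is only that the typed hypothesis is
not automatic and the origin certificate carries content.  Nothing of [SemiAnbd] is refuted or asserted;
no side is taken on [IUTchIII] Cor. 3.12.
-/

noncomputable section

open Topology Filter Set Function
open scoped Pointwise
open Literature.IUT.HodgeTheaters (profiniteCompletion toCompletion toCompletion_int_injective)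
open Literature.AlgebraicGeometry.Frobenioids (IsSlimGroup)
open Literature.AnabelianGeometry.AbsoluteAnabelian

namespace Literature.AnabelianGeometry.SemiGraphs

/-- Slimness is transported along isomorphisms of topological groups (bookkeeping; private copy).
[folklore] -/
private theorem isSlimGroup_of_continuousMulEquiv₄ {G₁ G₂ : Type*} [Group G₁] [TopologicalSpace G₁]
    [Group G₂] [TopologicalSpace G₂] (e : G₁ ≃ₜ* G₂) (h : IsSlimGroup G₁) : IsSlimGroup G₂ := by
  refine ⟨fun H hH => ?_⟩
  refine (Subgroup.eq_bot_iff_forall _).mpr fun z hz => ?_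
  have hH' : IsOpen ((H.comap e.toMulEquiv.toMonoidHom : Subgroup G₁) : Set G₁) :=
    hH.preimage e.continuous
  have hz' : e.symm z ∈ Subgroup.centralizer ((H.comap e.toMulEquiv.toMonoidHom : Subgroup G₁) : Set G₁) := by
    refine Subgroup.mem_centralizer_iff.mpr fun g hg => ?_
    have := Subgroup.mem_centralizer_iff.mp hz (e g) hg
    apply e.injective
    simpa [map_mul] using this
  rw [h.centralizer_eq_bot _ hH'] at hz'
  have : e.symm z = 1 := Subgroup.mem_bot.mp hz'
  simpa using congrArg e this

/-- **Thm. 6.5 (iii) AS TYPED fails at the genuine-arithmetic datum** `K = ℚ_p`, `Π^temp := G_{ℚ_p} × F̂₂`,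
one cusp with `I_x = 1 × îa(Ẑ)` (the datum of `TemperedCurveGroupLevelDataNonVacuity2.lean`, carrying
`GroupLevelData`, a cusp and nonabelian slim `Δ^temp`): the automorphism `id × ŝ` (`ŝ` = completed swap of
the free generators) does not preserve cuspidal geometric decomposition groups.
[cite: MochizukiSemiAnbd2006, Thm 6.5(iii) p.72] -/
theorem exists_temperedCurve_not_isoPreservesCuspidalDecomp (p : ℕ) [Fact p.Prime] :
    ∃ X : TemperedCurve p,
      X.K = ⊥ ∧ Function.Surjective X.aug ∧ Nonempty X.GroupLevelData ∧
      (∃ x : X.Pt, X.IsCusp x) ∧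
      (∃ g ∈ X.DeltaTemp, ∃ h ∈ X.DeltaTemp, g * h ≠ h * g) ∧
      IsSlimGroup X.PiTemp ∧ IsSlimGroup X.DeltaTemp ∧
      ¬ X.IsoPreservesCuspidalDecomp X := by
  classical
  -- instances on `G_{ℚ_p}`
  haveI : IsGalois ℚ_[p] (AlgebraicClosure ℚ_[p]) := {}
  haveI : T2Space (GQp p) := krullTopology_t2
  -- the profinite data (abc-iut-w5-d218's toolkit)
  let P : ProfiniteGrp.{0} := profiniteCompletion (FreeGroup (Fin 2))
  let Zh : ProfiniteGrp.{0} := profiniteCompletion (Multiplicative ℤ)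
  let η : FreeGroup (Fin 2) →* P := toCompletion (FreeGroup (Fin 2))
  let ι : Multiplicative ℤ →* Zh := toCompletion (Multiplicative ℤ)
  let a : FreeGroup (Fin 2) := FreeGroup.of 0
  let b : FreeGroup (Fin 2) := FreeGroup.of 1
  let σa : FreeGroup (Fin 2) →* Multiplicative ℤ :=
    FreeGroup.lift fun j => if j = (0 : Fin 2) then Multiplicative.ofAdd (1 : ℤ) else 1
  have hσaa : σa a = Multiplicative.ofAdd 1 := by simp [σa, a]
  have hσab : σa b = 1 := by simp [σa, b]
  let e : P →ₜ* Zh := (ProfiniteGrp.ProfiniteCompletion.lift (GrpCat.ofHom (ι.comp σa))).hom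
  let îa : Zh →ₜ* P :=
    (ProfiniteGrp.ProfiniteCompletion.lift (GrpCat.ofHom (η.comp (zpowersHom _ a)))).hom
  let îb : Zh →ₜ* P :=
    (ProfiniteGrp.ProfiniteCompletion.lift (GrpCat.ofHom (η.comp (zpowersHom _ b)))).hom
  have he : ∀ g, e (η g) = ι (σa g) := fun g => lift_hom_toCompletion Zh (ι.comp σa) g
  have hîa : ∀ k : ℤ, îa (ι (Multiplicative.ofAdd k)) = η (a ^ k) := fun k => by
    rw [lift_hom_toCompletion P (η.comp (zpowersHom _ a))]
    simp [zpowersHom_apply]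
  have hîb : ∀ k : ℤ, îb (ι (Multiplicative.ofAdd k)) = η (b ^ k) := fun k => by
    rw [lift_hom_toCompletion P (η.comp (zpowersHom _ b))]
    simp [zpowersHom_apply]
  have heîa : ∀ t, e (îa t) = t := TemperedFibreProduct.apply_apply_eq_self_of a σa hσaa e îa he hîa
  have hιinj : Function.Injective ι := toCompletion_int_injective
  -- `η a` and `η b` do not commute: else `η a ∈ C(η b) ⊆ îb(Ẑ)`, and `e` kills `îb(Ẑ)` but not `η a`
  have hnc : η a * η b ≠ η b * η a := by
    intro hab
    have hz' : η a ∈ Subgroup.centralizer ({η (b ^ (1 : ℤ))} : Set P) := by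
      rw [zpow_one]; exact Subgroup.mem_centralizer_singleton_iff.mpr hab
    obtain ⟨t, ht⟩ := TemperedFibreProduct.closure_eta_zpowers_subset_range b îb hîb
      (TemperedFibreProduct.centralizer_eta_of_zpow_subset 1 one_ne_zero hz')
    have h1 : e (η a) = ι (Multiplicative.ofAdd 1) := by rw [he, hσaa]
    have h2 : e (η a) = 1 := by
      rw [← ht]; exact TemperedFibreProduct.apply_apply_eq_one_of b σa hσab e îb he hîb t
    rw [h1, ← map_one ι] at h2
    exact absurd (hιinj h2) (by decide)
  -- the group `Π := G_{ℚ_p} × F̂₂`, the inertia `I := îa(Ẑ)` and the decomposition group `D := G_{ℚ_p} × I`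
  let I : Subgroup P := îa.toMonoidHom.range
  have hIclosed : IsClosed (I : Set P) := by
    have : (I : Set P) = Set.range îa := by ext x; simp [I]
    rw [this]; exact (isCompact_range îa.continuous).isClosed
  let D : Subgroup (GQp p × P) := I.comap (MonoidHom.snd (GQp p) P)
  have hDmem : ∀ x : GQp p × P, x ∈ D ↔ x.2 ∈ I := fun x => Iff.rfl
  have hDclosed : IsClosed (D : Set (GQp p × P)) := by
    have : (D : Set (GQp p × P)) = Prod.snd ⁻¹' (I : Set P) := by
      ext x; exact hDmem x
    rw [this]; exact hIclosed.preimage continuous_snd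
  let fstH : GQp p × P →ₜ* GQp p := ContinuousMonoidHom.fst _ _
  have hfstD : fstH '' (D : Set (GQp p × P)) = Set.univ :=
    Set.eq_univ_of_forall fun g => ⟨(g, 1), (hDmem _).2 I.one_mem, rfl⟩
  -- the inertia `D ∩ Ker(pr₁) = 1 × îa(Ẑ) ≃ₜ* Ẑ` via `ê_a` (left inverse of `îa`)
  have hinertia : Nonempty (↥(D ⊓ fstH.toMonoidHom.ker) ≃ₜ* ZHat) := by
    refine ⟨{ toFun := fun x => e x.1.2
              invFun := fun t => ⟨(1, îa t), (hDmem _).2 ⟨t, rfl⟩, (MonoidHom.mem_ker).2 rfl⟩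
              left_inv := fun x => ?_
              right_inv := fun t => heîa t
              map_mul' := fun x y => by
                change e ((x : GQp p × P) * y).2 = e (x : GQp p × P).2 * e (y : GQp p × P).2
                rw [Prod.snd_mul, map_mul]
              continuous_toFun := e.continuous.comp (continuous_snd.comp continuous_subtype_val)
              continuous_invFun := (continuous_const.prodMk îa.continuous).subtype_mk _ }⟩
    obtain ⟨⟨g, z⟩, hgz⟩ := x
    have hg : g = 1 := (MonoidHom.mem_ker).1 (Subgroup.mem_inf.1 hgz).2
    obtain ⟨u, hu⟩ : z ∈ I := (hDmem _).1 (Subgroup.mem_inf.1 hgz).1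
    apply Subtype.ext
    change ((1 : GQp p), îa (e z)) = (g, z)
    rw [hg, ← hu]
    exact Prod.ext rfl (congrArg îa (heîa u))
  -- the curve-level datum
  let X : TemperedCurve p :=
    { K := ⊥
      finiteDimensional_K := inferInstance
      PiTemp := GQp p × P
      aug := fstH
      range_aug := by
        rw [IntermediateField.fixingSubgroup_bot]
        exact MonoidHom.range_eq_top.mpr Prod.fst_surjective
      PiHat := GQp p × P
      toHat := ContinuousMonoidHom.id _
      isProfiniteCompletion_toHat := isProfiniteCompletion_id _
      toHat_injective := Function.injective_id
      augHat := fstH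
      augHat_comp := fun _ => rfl
      Pt := Unit
      IsCusp := fun _ => True
      decomp := fun _ => D
      isClosed_decomp := fun _ => hDclosed
      isOpen_aug_decomp := fun _ => by
        change IsOpen (fstH '' (D : Set (GQp p × P)))
        rw [hfstD]; exact isOpen_univ
      inertia_eq_bot := fun _ h => (h trivial).elim
      inertia_equiv_zHat := fun _ _ => hinertia }
  -- group-level facts about `Π = G_{ℚ_p} × F̂₂`
  have hT : IsTempered (GQp p × P) := IsTempered.of_profinite
  have hslimP : IsSlimGroup P := isSlimGroup_profiniteCompletion_freeGroupTwo
  have hslimG : IsSlimGroup (GQp p) := IsSubpadicFor.isSlimGroup_absoluteGaloisGroup (AbsTopIII.IsSubpadicFor.padic p)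
  have hslim : IsSlimGroup (GQp p × P) := isSlimGroup_prod_of_profinite hslimG hslimP
  haveI hscG : SecondCountableTopology (GQp p) :=
    Literature.NumberTheory.LocalFields.secondCountableTopology_galQp p
  haveI hscP : SecondCountableTopology P := secondCountableTopology_profiniteCompletion_freeGroup (Fin 2)
  have hsc : SecondCountableTopology (GQp p × P) := inferInstance
  -- `Δ^temp = Ker(pr₁) = 1 × F̂₂ ≃ₜ* F̂₂`
  have hΔmem : ∀ x : GQp p × P, x ∈ X.DeltaTemp ↔ x.1 = 1 := fun x => MonoidHom.mem_ker
  have eΔ : ∀ (H : Subgroup (GQp p × P)), (∀ x, x ∈ H ↔ x.1 = 1) → Nonempty (P ≃ₜ* H) :=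
    fun H hH =>
      ⟨{ toFun := fun z => ⟨(1, z), (hH _).2 rfl⟩
         invFun := fun y => y.1.2
         left_inv := fun z => rfl
         right_inv := fun y => by
           apply Subtype.ext
           exact Prod.ext ((hH _).1 y.2).symm rfl
         map_mul' := fun z w => Subtype.ext (Prod.ext (by simp) rfl)
         continuous_toFun := (continuous_const.prodMk continuous_id).subtype_mk _
         continuous_invFun := continuous_snd.comp continuous_subtype_val }⟩
  have hslimΔ : IsSlimGroup X.DeltaTemp := by
    obtain ⟨eH⟩ := eΔ X.DeltaTemp hΔmem
    exact isSlimGroup_of_continuousMulEquiv₄ eH hslimP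
  -- the `GroupLevelData`
  let ιG := X.galoisIdentification
  have hkermem : ∀ x : GQp p × P, x ∈ (X.augK ιG).toMonoidHom.ker ↔ x.1 = 1 := fun x => by
    rw [TemperedCurve.ker_augK]; exact hΔmem x
  have hkerClosed : IsClosed (((X.augK ιG).toMonoidHom.ker : Subgroup (GQp p × P)) : Set (GQp p × P)) := by
    have : (((X.augK ιG).toMonoidHom.ker : Subgroup (GQp p × P)) : Set (GQp p × P)) =
        Prod.fst ⁻¹' {1} := by
      ext x; exact hkermem x
    rw [this]; exact isClosed_singleton.preimage continuous_fst
  have hslimKer : IsSlimGroup (X.augK ιG).toMonoidHom.ker := by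
    obtain ⟨eH⟩ := eΔ _ hkermem
    exact isSlimGroup_of_continuousMulEquiv₄ eH hslimP
  let d : X.GroupLevelData :=
    { galEquiv := ιG
      isTempered := hT
      isTempered_ker := hT.subgroup_of_isClosed _ hkerClosed
      isSlimGroup := hslim
      isSlimGroup_ker := hslimKer
      secondCountableTopology := hsc }
  have hg : ((1 : GQp p), η a) ∈ X.DeltaTemp := (hΔmem _).2 rfl
  have hh : ((1 : GQp p), η b) ∈ X.DeltaTemp := (hΔmem _).2 rfl
  have hgh : ((1 : GQp p), η a) * ((1 : GQp p), η b) ≠ ((1 : GQp p), η b) * ((1 : GQp p), η a) :=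
    fun hc => hnc (by simpa using congrArg Prod.snd hc)
  -- the completed exponent sum `ê_b` and the completed swap `ŝ : F̂₂ ≃ₜ* F̂₂`, `ŝ(η a) = η b`
  let σb : FreeGroup (Fin 2) →* Multiplicative ℤ :=
    FreeGroup.lift fun j => if j = (1 : Fin 2) then Multiplicative.ofAdd (1 : ℤ) else 1
  have hσbb : σb b = Multiplicative.ofAdd 1 := by simp [σb, b]
  let êb : P →ₜ* Zh := (ProfiniteGrp.ProfiniteCompletion.lift (GrpCat.ofHom (ι.comp σb))).hom
  have hêb : ∀ g, êb (η g) = ι (σb g) := fun g => lift_hom_toCompletion Zh (ι.comp σb) g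
  let sw : FreeGroup (Fin 2) →* FreeGroup (Fin 2) := FreeGroup.map (Equiv.swap (0 : Fin 2) 1)
  have hswsw : ∀ g, sw (sw g) = g := fun g => by
    change FreeGroup.map _ (FreeGroup.map _ g) = g
    rw [FreeGroup.map.comp]
    have : ((Equiv.swap (0 : Fin 2) 1) ∘ (Equiv.swap (0 : Fin 2) 1) : Fin 2 → Fin 2) = id := by
      funext j; simp [Equiv.swap_apply_self]
    rw [this, FreeGroup.map.id]
  have hswa : sw a = b := by
    change FreeGroup.map _ (FreeGroup.of 0) = FreeGroup.of 1
    rw [FreeGroup.map.of, Equiv.swap_apply_left]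
  let s : P →ₜ* P := (ProfiniteGrp.ProfiniteCompletion.lift (GrpCat.ofHom (η.comp sw))).hom
  have hs : ∀ g, s (η g) = η (sw g) := fun g => lift_hom_toCompletion P (η.comp sw) g
  have hss : ∀ z, s (s z) = z := by
    have hd : DenseRange η := ProfiniteGrp.ProfiniteCompletion.denseRange (GrpCat.of (FreeGroup (Fin 2)))
    have key : (fun z => s (s z)) = id := by
      refine hd.equalizer (s.continuous.comp s.continuous) continuous_id ?_
      funext g
      simp only [Function.comp_apply, id_eq]
      rw [hs, hs, hswsw]
    exact fun z => congrFun key z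
  let ŝ : P ≃ₜ* P :=
    { toFun := s, invFun := s, left_inv := hss, right_inv := hss, map_mul' := map_mul s
      continuous_toFun := s.continuous, continuous_invFun := s.continuous }
  let α : (GQp p × P) ≃ₜ* (GQp p × P) :=
    { toFun := fun x => (x.1, s x.2)
      invFun := fun x => (x.1, s x.2)
      left_inv := fun x => Prod.ext rfl (hss x.2)
      right_inv := fun x => Prod.ext rfl (hss x.2)
      map_mul' := fun x y => Prod.ext rfl (map_mul s x.2 y.2)
      continuous_toFun := continuous_fst.prodMk (s.continuous.comp continuous_snd)
      continuous_invFun := continuous_fst.prodMk (s.continuous.comp continuous_snd) }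
  -- Thm 6.5 (iii) AS TYPED fails for `α = id × ŝ`: the image of `I_x ∋ (1, η a)` contains `(1, η b)`,
  -- but every conjugate `c I_x c⁻¹ = 1 × c₂ îa(Ẑ) c₂⁻¹` is killed by `ê_a` while `ê_b(η b) ≠ 1`
  have hIxmem : ∀ y : GQp p × P, y ∈ X.inertia () ↔ y.2 ∈ I ∧ y.1 = 1 := fun y => by
    change y ∈ D ⊓ X.DeltaTemp ↔ _
    rw [Subgroup.mem_inf, hDmem, hΔmem]
  have haI : η a ∈ I := ⟨ι (Multiplicative.ofAdd (1 : ℤ)), by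
    change îa _ = _
    rw [hîa, zpow_one]⟩
  have haIx : ((1 : GQp p), η a) ∈ X.inertia () := (hIxmem _).2 ⟨haI, rfl⟩
  have hnot : ¬ X.IsoPreservesCuspidalDecomp X := by
    intro h65
    have hcg : X.IsCuspidalGeometricDecompositionGroup (X.inertia ()) :=
      ⟨(), trivial, 1, (one_smul _ _).symm⟩
    obtain ⟨x, -, γ, hγ⟩ := (h65 α (X.inertia ())).2 hcg
    obtain ⟨⟩ := x
    -- `(1, η b) = α (1, η a)` lies in the image, hence in `γ • I_x`
    have hb_img : ((1 : GQp p), η b) ∈ (X.inertia ()).map α.toMulEquiv.toMonoidHom := by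
      refine ⟨((1 : GQp p), η a), haIx, ?_⟩
      change ((1 : GQp p), s (η a)) = ((1 : GQp p), η b)
      rw [hs, hswa]
    rw [hγ, ← ConjAct.toConjAct_ofConjAct γ, mem_conjAct_smul_iff] at hb_img
    set d : GQp p × P := ConjAct.ofConjAct γ with hd
    -- its second component `d₂⁻¹ · η b · d₂` lies in `îa(Ẑ)`; evaluate `ê_a`
    obtain ⟨hI2, -⟩ := (hIxmem _).1 hb_img
    obtain ⟨t, ht⟩ := hI2
    have ht' : îa t = (d⁻¹ * ((1 : GQp p), η b) * d).2 := ht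
    have h1 : e (îa t) = 1 := by
      rw [ht']
      change e (d.2⁻¹ * η b * d.2) = 1
      rw [map_mul, map_mul, map_inv, he, hσab, map_one, mul_one, inv_mul_cancel]
    rw [heîa] at h1
    subst h1
    -- so `d₂⁻¹ η(b) d₂ = 1`, i.e. `η b = 1` — contradicting `ê_b(η b) = ι(1) ≠ 1`
    have hb1 : d.2⁻¹ * η b * d.2 = 1 := by
      have := ht'
      rw [map_one] at this
      exact (this.symm : (d⁻¹ * ((1 : GQp p), η b) * d).2 = 1)
    have hb1' : η b = 1 := by
      have := congrArg (fun w => d.2 * w * d.2⁻¹) hb1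
      simpa [mul_assoc] using this
    have : ι (Multiplicative.ofAdd (1 : ℤ)) = 1 := by rw [← hσbb, ← hêb, hb1', map_one]
    rw [← map_one ι] at this
    exact absurd (hιinj this) (by decide)
  refine ⟨X, rfl, Prod.fst_surjective, ⟨d⟩, ⟨(), trivial⟩, ⟨_, hg, _, hh, hgh⟩, hslim, hslimΔ, hnot⟩

end Literature.AnabelianGeometry.SemiGraphs

end
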